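import Literature.NumberTheory.Automorphic.AdeleAwayFromPlaces
import Literature.NumberTheory.Automorphic.QuaternionAdelicUnitsPlacesSplitting
import Literature.Topology.Algebra.IdempotentUnitsQuotient
import HarnessLib

/-!
# `D^{S,×} ≅ (𝔸_K^S ⊗_K D)ˣ`: the units of `D_𝔸` trivial at the places of `S` are the units of `D`
# over the adeles away from `S`
(Gelbart, *Automorphic forms on adele groups* (1975), §10, p. 153: `G'^S` for `G' = Dˣ`)

Topic `NumberTheory/Automorphic`; definitions with bodies (`Quat.placesIdem`,
`Quat.awayProj`, `Quat.awaySection`, `Quat.cornerUnitsEquivAwayUnits`,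
`Quat.trivialAtEquivAwayUnits`) and theorems; no named fact, no instance.

For a finite-dimensional `K`-algebra `D` and a finite set `S` of finite places, let
`E_S = e_S ⊗ 1 ∈ D_𝔸 = 𝔸_K ⊗_K D` (`Quat.placesIdem`, a central idempotent; `e_S = adelePlacesIdem K S`).
The subgroup `D^{S,×} = {x ∈ D_𝔸ˣ : x_v = 1 for v ∈ S}` (`Quat.trivialAt` of
`QuaternionAdelicUnitsPlacesSplitting`) is the group of units supported off `E_S`,
`Literature.Topology.Algebra.cornerUnits (1 - E_S)` (`Quat.trivialAt_eq_cornerUnits`: `x_v = 1` iff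
`E_v x = E_v`, `Quat.toCompletionUnits_eq_one_iff_placeIdem_mul`, and `E_S = Σ_{v ∈ S} E_v` with
`E_v E_S = E_v`). The projection `q = mk ⊗ 1 : 𝔸_K ⊗_K D → 𝔸_K^S ⊗_K D` (`Quat.awayProj`,
`𝔸_K^S = AdeleAway K S = 𝔸_K ⧸ (e_S)`) and the section `σ = lift ⊗ 1` (`Quat.awaySection`,
`lift(x̄) = (1 - e_S) x`) satisfy `q ∘ σ = id`, `σ ∘ q = ((1 - E_S) ·)` and are continuous, so
`Literature.Topology.Algebra.cornerUnitsContinuousEquivOfSection` (`IdempotentUnitsQuotient`) gives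

* `Quat.trivialAtEquivAwayUnits K D S : D^{S,×} ≃ₜ* (𝔸_K^S ⊗_K D)ˣ` — **the units of `D_𝔸` trivial at
  `S` are the units of `D` over the adeles away from `S`, as topological groups.**

With `𝔸_K^S ⊗_K D ≅ M₂(𝔸_K^S)` for a quaternion algebra `D` unramified outside `S`
(`QuaternionNormEquationAdelic` + `QuaternionAlgebra.splitEquiv`) this is Gelbart's `G'^S = G^S`.
Part of the inline (D-0026) decomposition of
`Literature.NumberTheory.Automorphic.strong_multiplicity_one_quaternionUnits`.

## References

* S. Gelbart, *Automorphic forms on adele groups*, Ann. of Math. Studies 83 (1975), §10, p. 153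
  [Gelbart1975].
* A. Weil, *Basic Number Theory* (1967), Ch. IV §1 [WeilBNT1967].
-/

noncomputable section

open scoped TensorProduct
open NumberField IsDedekindDomain Topology
open Literature.Topology.Algebra

universe u

namespace Literature.NumberTheory.Automorphic

section Away

variable (K : Type) [Field K] [NumberField K] (D : Type u) [Ring D] [Algebra K D]
  (S : Finset (HeightOneSpectrum (𝓞 K)))

/-- **The idempotent `E_S = e_S ⊗ 1 ∈ D_𝔸`** of the places of `S`. [folklore] -/
def Quat.placesIdem : ScalarExtension K (AdeleRing (𝓞 K) K) D :=
  algebraMap (AdeleRing (𝓞 K) K) _ (adelePlacesIdem K S)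

/-- `E_S` is an idempotent. [folklore] -/
theorem Quat.isIdempotentElem_placesIdem : IsIdempotentElem (Quat.placesIdem K D S) := by
  rw [IsIdempotentElem, Quat.placesIdem, ← map_mul, (isIdempotentElem_adelePlacesIdem S).eq]

/-- `E_S` is central. [folklore] -/
theorem Quat.placesIdem_mem_center :
    Quat.placesIdem K D S ∈ Subring.center (ScalarExtension K (AdeleRing (𝓞 K) K) D) :=
  Subring.mem_center_iff.2 fun X => (Algebra.commutes _ X).symm

/-- `E_S = Σ_{v ∈ S} E_v`, `E_v = e_v ⊗ 1`. [folklore] -/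
theorem Quat.placesIdem_eq_sum : Quat.placesIdem K D S =
    ∑ v ∈ S, algebraMap (AdeleRing (𝓞 K) K) (ScalarExtension K (AdeleRing (𝓞 K) K) D) (adeleSingleHom K v 1) := by
  rw [Quat.placesIdem, adelePlacesIdem, _root_.map_sum]

variable {K D S} in
/-- `E_v E_S = E_v` for `v ∈ S`. [folklore] -/
theorem Quat.placeIdem_mul_placesIdem {v : HeightOneSpectrum (𝓞 K)} (hv : v ∈ S) :
    algebraMap (AdeleRing (𝓞 K) K) (ScalarExtension K (AdeleRing (𝓞 K) K) D) (adeleSingleHom K v 1) *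
      Quat.placesIdem K D S =
      algebraMap (AdeleRing (𝓞 K) K) (ScalarExtension K (AdeleRing (𝓞 K) K) D) (adeleSingleHom K v 1) := by
  rw [Quat.placesIdem, ← map_mul, mul_comm, adelePlacesIdem_mul_adeleSingleHom_of_mem hv]

variable {K D S} in
/-- **`x_v = 1` iff `E_v x = E_v`** (`E_v y = ι_v(y_v)`, `Quat.algebraMap_adeleSingleHom_one_mul`, and
`ι_v` is injective). [folklore] -/
theorem Quat.toCompletionUnits_eq_one_iff_placeIdem_mul (v : HeightOneSpectrum (𝓞 K)) (x : adelicUnits K D) :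
    toCompletionUnits K D v x = 1 ↔
      algebraMap (AdeleRing (𝓞 K) K) (ScalarExtension K (AdeleRing (𝓞 K) K) D) (adeleSingleHom K v 1) *
          (x : ScalarExtension K (AdeleRing (𝓞 K) K) D) =
        algebraMap (AdeleRing (𝓞 K) K) (ScalarExtension K (AdeleRing (𝓞 K) K) D) (adeleSingleHom K v 1) := by
  have hE : algebraMap (AdeleRing (𝓞 K) K) (ScalarExtension K (AdeleRing (𝓞 K) K) D) (adeleSingleHom K v 1) =
      Quat.localToAdelic K D v 1 := by
    rw [← mul_one (algebraMap _ _ (adeleSingleHom K v 1)), Quat.algebraMap_adeleSingleHom_one_mul, map_one]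
  rw [Quat.algebraMap_adeleSingleHom_one_mul, hE, Units.ext_iff, Units.val_one]
  change ScalarExtension.mapLeft K D (adeleEvalAlgHom K v) (x : ScalarExtension K (AdeleRing (𝓞 K) K) D) = 1 ↔ _
  constructor
  · intro h
    rw [h]
  · intro h
    exact Function.LeftInverse.injective (Quat.mapLeft_localToAdelic K D v) h

variable {K D S} in
/-- **`D^{S,×} = U_{1-E_S}`**: a unit of `D_𝔸` is trivial at the places of `S` iff `E_S x = E_S`, i.e.
iff it lies in the corner unit group of `1 - E_S`. [folklore] -/
theorem Quat.mem_trivialAt_iff_mem_cornerUnits {x : adelicUnits K D} :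
    x ∈ Quat.trivialAt K D S ↔ x ∈ cornerUnits (1 - Quat.placesIdem K D S) := by
  rw [Quat.mem_trivialAt_iff, mem_cornerUnits_iff, sub_sub_cancel]
  constructor
  · intro h
    rw [Quat.placesIdem_eq_sum, Finset.sum_mul]
    exact Finset.sum_congr rfl fun v hv => (Quat.toCompletionUnits_eq_one_iff_placeIdem_mul v x).1 (h v hv)
  · intro h v hv
    rw [Quat.toCompletionUnits_eq_one_iff_placeIdem_mul]
    have h' : algebraMap (AdeleRing (𝓞 K) K) (ScalarExtension K (AdeleRing (𝓞 K) K) D) (adeleSingleHom K v 1) *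
        (Quat.placesIdem K D S * (x : ScalarExtension K (AdeleRing (𝓞 K) K) D)) =
        algebraMap (AdeleRing (𝓞 K) K) (ScalarExtension K (AdeleRing (𝓞 K) K) D) (adeleSingleHom K v 1) *
          Quat.placesIdem K D S := by rw [h]
    rwa [← mul_assoc, Quat.placeIdem_mul_placesIdem hv] at h'

variable {K D S} in
/-- The same as an equality of subgroups. [folklore] -/
theorem Quat.trivialAt_eq_cornerUnits : Quat.trivialAt K D S = cornerUnits (1 - Quat.placesIdem K D S) :=
  Subgroup.ext fun _ => Quat.mem_trivialAt_iff_mem_cornerUnits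

/-- **The projection `q = mk ⊗ 1 : 𝔸_K ⊗_K D → 𝔸_K^S ⊗_K D`** onto `D` over the adeles away from `S`.
[folklore] -/
def Quat.awayProj : ScalarExtension K (AdeleRing (𝓞 K) K) D →ₐ[K] ScalarExtension K (AdeleAway K S) D :=
  ScalarExtension.mapLeft K D (AdeleAway.mk K S)

/-- **The section `σ = lift ⊗ 1 : 𝔸_K^S ⊗_K D → 𝔸_K ⊗_K D`** (`lift(x̄) = (1 - e_S) x`). [folklore] -/
def Quat.awaySection : ScalarExtension K (AdeleAway K S) D →ₗ[K] ScalarExtension K (AdeleRing (𝓞 K) K) D :=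
  ScalarExtension.mapLeftLinear K D ((AdeleAway.lift K S).restrictScalars K)

variable {K D S}

/-- `q (σ y) = y`. [folklore] -/
theorem Quat.awayProj_awaySection (y : ScalarExtension K (AdeleAway K S) D) :
    Quat.awayProj K D S (Quat.awaySection K D S y) = y := by
  induction y using ScalarExtension.induction_on' K (AdeleAway K S) D with
  | zero => rw [map_zero, map_zero]
  | tmul r d =>
    rw [Quat.awaySection, ScalarExtension.mapLeftLinear_tmul, Quat.awayProj, ScalarExtension.mapLeft_tmul,
      LinearMap.restrictScalars_apply, AdeleAway.mk_lift]
  | add X Y hX hY => rw [map_add, map_add, hX, hY]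

/-- `σ (q x) = (1 - E_S) x`. [folklore] -/
theorem Quat.awaySection_awayProj (x : ScalarExtension K (AdeleRing (𝓞 K) K) D) :
    Quat.awaySection K D S (Quat.awayProj K D S x) = (1 - Quat.placesIdem K D S) * x := by
  have h1 : (1 - Quat.placesIdem K D S) =
      algebraMap (AdeleRing (𝓞 K) K) (ScalarExtension K (AdeleRing (𝓞 K) K) D) (1 - adelePlacesIdem K S) := by
    rw [map_sub, map_one, Quat.placesIdem]
  rw [h1]
  induction x using ScalarExtension.induction_on' K (AdeleRing (𝓞 K) K) D with
  | zero => rw [map_zero, map_zero, mul_zero]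
  | tmul a d =>
    rw [Quat.awayProj, ScalarExtension.mapLeft_tmul, Quat.awaySection, ScalarExtension.mapLeftLinear_tmul,
      LinearMap.restrictScalars_apply, AdeleAway.lift_mk, Algebra.algebraMap_eq_smul_one,
      ScalarExtension.one_eq_ofTensor, ← map_smul, TensorProduct.smul_tmul', smul_eq_mul, mul_one,
      ← ScalarExtension.ofTensor_mul, Algebra.TensorProduct.tmul_mul_tmul, one_mul]
  | add X Y hX hY => rw [map_add, map_add, hX, hY, mul_add]

variable (K D S)

/-- `q` is continuous (module topologies). [folklore] -/
theorem Quat.continuous_awayProj [Module.Finite K D] : Continuous (Quat.awayProj K D S) :=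
  ScalarExtension.continuous_mapLeft K _ D (AdeleAway.mk K S) (AdeleAway.continuous_mk K S)

/-- `σ` is continuous (module topologies). [folklore] -/
theorem Quat.continuous_awaySection [Module.Finite K D] : Continuous (Quat.awaySection K D S) :=
  ScalarExtension.continuous_mapLeftLinear K D _ (AdeleAway.continuous_lift K S)

/-- **`U_{1-E_S} ≃ₜ* (𝔸_K^S ⊗_K D)ˣ`**: `cornerUnitsContinuousEquivOfSection` for `q = mk ⊗ 1`, `σ = lift ⊗ 1`.
[folklore] -/
def Quat.cornerUnitsEquivAwayUnits [Module.Finite K D] :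
    cornerUnits (1 - Quat.placesIdem K D S) ≃ₜ* (ScalarExtension K (AdeleAway K S) D)ˣ :=
  cornerUnitsContinuousEquivOfSection (Quat.isIdempotentElem_placesIdem K D S) (Quat.placesIdem_mem_center K D S)
    (Quat.awayProj K D S).toRingHom (Quat.awaySection K D S)
    (fun y => Quat.awayProj_awaySection y) (fun x => Quat.awaySection_awayProj x)
    (Quat.continuous_awayProj K D S) (Quat.continuous_awaySection K D S)

/-- **`D^{S,×} ≃ₜ* (𝔸_K^S ⊗_K D)ˣ`** (Gelbart's `G'^S`): the units of `D_𝔸` trivial at the places of `S`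
are the units of `D` over the adeles away from `S`, as topological groups; the isomorphism is
`x ↦ (mk ⊗ 1)(x)`, its inverse `u ↦ E_S + (1 - E_S)(lift ⊗ 1)(u)`. [cite: Gelbart1975, §10 p. 153] -/
def Quat.trivialAtEquivAwayUnits [Module.Finite K D] :
    Quat.trivialAt K D S ≃ₜ* (ScalarExtension K (AdeleAway K S) D)ˣ :=
  (continuousMulEquivOfSubgroupEq Quat.trivialAt_eq_cornerUnits).trans (Quat.cornerUnitsEquivAwayUnits K D S)

variable {K D S} in
/-- The isomorphism is `x ↦ (mk ⊗ 1)(x)` on underlying elements. [folklore] -/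
theorem Quat.coe_trivialAtEquivAwayUnits [Module.Finite K D] (x : Quat.trivialAt K D S) :
    ((Quat.trivialAtEquivAwayUnits K D S x : (ScalarExtension K (AdeleAway K S) D)ˣ) : ScalarExtension K (AdeleAway K S) D) =
      Quat.awayProj K D S ((x : adelicUnits K D) : ScalarExtension K (AdeleRing (𝓞 K) K) D) := rfl

variable {K D S} in
/-- The inverse is `u ↦ E_S + (1 - E_S) (lift ⊗ 1)(u)` on underlying elements. [folklore] -/
theorem Quat.coe_trivialAtEquivAwayUnits_symm [Module.Finite K D] (u : (ScalarExtension K (AdeleAway K S) D)ˣ) :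
    ((((Quat.trivialAtEquivAwayUnits K D S).symm u : Quat.trivialAt K D S) : adelicUnits K D) :
        ScalarExtension K (AdeleRing (𝓞 K) K) D) =
      Quat.placesIdem K D S + (1 - Quat.placesIdem K D S) * Quat.awaySection K D S (u : ScalarExtension K (AdeleAway K S) D) := rfl

/-- **The projection `D_𝔸ˣ → (𝔸_K^S ⊗_K D)ˣ` is onto.** [folklore] -/
theorem Quat.units_map_awayProj_surjective [Module.Finite K D] :
    Function.Surjective (Units.map ((Quat.awayProj K D S).toRingHom : ScalarExtension K (AdeleRing (𝓞 K) K) D →*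
      ScalarExtension K (AdeleAway K S) D)) :=
  units_map_surjective (Quat.isIdempotentElem_placesIdem K D S) (Quat.placesIdem_mem_center K D S)
    (Quat.awayProj K D S).toRingHom (Quat.awaySection K D S)
    (fun y => Quat.awayProj_awaySection y) (fun x => Quat.awaySection_awayProj x)

end Away

end Literature.NumberTheory.Automorphic
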